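import Literature.NumberTheory.Automorphic.AdelicUnitaryGroupMeasure
import Literature.MeasureTheory.Group.InvariantQuotientCompactFibre
import Literature.MeasureTheory.Group.InvariantQuotientConjugacySum
import Literature.MeasureTheory.Group.InvariantQuotientExistence
import HarnessLib

/-!
# The conjugacy classes of an anisotropic group for the trace formula: compact centraliser
quotients, unimodularity, orbital measures — the unitary group `U(H)` of a CM field
(Deitmar–Echterhoff, *Principles of Harmonic Analysis* (2014), Prop. 9.1.5, Lemma 9.3.3;
Gelbart (1975), Remark 9.23; Rogawski (1990), §14.5)

Topic `NumberTheory/Automorphic`; namespace `Literature.NumberTheory.Automorphic` (grouping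
sub-namespaces `AdelicGroupData`, `UnitaryGroup`). Proof file: theorems only, no definition, no named
fact, no `sorry`; imports = tree + Mathlib.

The tree's generic geometric side of the trace formula on a compact automorphic quotient
(`AdelicGroupData.exists_lintegral_conjTsum_eq_tsum`, `AdelicGroupData.integral_quotientKernel_diag_eq_mul_tsum`,
`AutomorphicQuotientKernelGeometric`) takes PER-CLASS inputs: for every conjugacy class `[γ]` of
`G(K)`, compactness of `G_γ ⧸ (A_G G(K) ∩ G_γ)` (`G_γ = C_{G(𝔸)}(γ)`) and non-zero invariant measures
finite on compact sets on `G(𝔸) ⧸ G_γ` and on `G(𝔸) ⧸ (A_G G(K) ∩ G_γ)`. The model instance is `D^×`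
(`QuaternionUnitsTraceClasses`: centralisers are tori). This file discharges them for every adelic
group datum with **trivial split centre `A_G = ⊥`, discrete `G(K)` and compact automorphic quotient**
(the anisotropic regime), and specialises to the unitary group `U(H)` of an ANISOTROPIC hermitian
matrix `H ∈ M_N(L)` over a CM field (`UnitaryGroup.cmDatum L N H`, `AdelicUnitaryGroupDatum`; compact
quotient by the tree's Godement criterion `compactSpace_cmDatum_automorphicQuotient`) — Rogawski's
inner form `G′ = U(V)` for `D = M₃(E)` (*Automorphic representations of unitary groups in three
variables* (1990), §14.5 p. 237 (print): "since `G′` is anisotropic, `T_{G′}(f′)` is the trace of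
`ρ(f′)` on `L(G′)`", whose `O`-expansion these inputs feed).

* `exists_isCompact_centralizer_subset_mul`, `compactSpace_centralizer_quotient_of_le` — **the
  purely topological heart**: `G` locally compact Hausdorff, `L ≤ G` with `G ⧸ L` compact, `Γ ≤ L`
  DISCRETE with `L = Γ · C_L(Γ)` (e.g. `L = A Γ`, `A` central), `γ ∈ Γ`. Then
  `C_G(γ) ⊆ K · (L ∩ C_G(γ))` for a compact `K ⊆ C_G(γ)`, so `C_G(γ) ⧸ (L ∩ C_G(γ))` is compact —
  the classical compactness of `Γ_γ \ G_γ` for a uniform lattice (Gelfand–Graev–Piatetski-Shapiro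
  (1969), Ch. 1 §2; Deitmar–Echterhoff Lemma 9.3.3 proves the finite-volume form analytically).
  Proof: `G = C · L`, `C` compact; for `g ∈ C_G(γ)` write `g = c δ a` (`c ∈ C`, `δ ∈ Γ`, `a ∈ C(Γ)`),
  then `δ γ δ⁻¹ = c⁻¹ γ c` lies in the FINITE set `Γ ∩ C⁻¹ γ C`; with one `δ_t ∈ Γ` per such
  conjugate `t`, `g = (c δ_t)(δ_t⁻¹ δ a) ∈ (C δ_t ∩ C_G(γ)) · (L ∩ C_G(γ))`. No semisimplicity of
  `γ` is needed.
* `exists_smulInvariantMeasure_quotient_of_isMulRightInvariant` — closed subgroup `M` with `G`, `M`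
  unimodular ⇒ non-zero `G`-invariant Radon measure on `G ⧸ M` (tree `quotientMeasure`;
  Deitmar–Echterhoff Thm. 1.5.3).
* `AdelicGroupData.compactSpace_centralizer_quotient` — for ANY datum with discrete `G(K)` and compact
  automorphic quotient: `G_γ ⧸ (A_G G(K) ∩ G_γ)` is compact for every rational `γ`.
* For `A_G = ⊥` (`quotientSubgroup = arithmeticSubgroup`, discrete and closed):
  `AdelicGroupData.isMulRightInvariant_of_center'_eq_bot` (**`G(𝔸)` is unimodular** — it carries
  the uniform lattice `G(K)`; Deitmar–Echterhoff Prop. 9.1.5 / Thm. 9.1.6, tree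
  `LevelOrbit.isMulRightInvariant_of_compactSpace_quotient`),
  `AdelicGroupData.isMulRightInvariant_centralizer_of_center'_eq_bot` (**`G_γ` is unimodular** —
  uniform lattice `G(K)_γ`; Lemma 9.3.3),
  `AdelicGroupData.exists_smulInvariantMeasure_quotient_centralizer_of_center'_eq_bot` and
  `…_quotient_inf_centralizer_…` (**the orbital measures** on `G(𝔸) ⧸ G_γ` and `G(𝔸) ⧸ G(K)_γ`).
* `UnitaryGroup.compactSpace_centralizer_quotient_cmDatum`, `UnitaryGroup.isMulRightInvariant_cmDatum`,
  `UnitaryGroup.isMulRightInvariant_centralizer_cmDatum`,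
  `UnitaryGroup.exists_smulInvariantMeasure_quotient_centralizer_cmDatum`,
  `UnitaryGroup.exists_smulInvariantMeasure_quotient_inf_centralizer_cmDatum` — the same for `U(H)`,
  `H` anisotropic.

The assembly with the kernel (`∫_X K_Φ(x, x) dμ = κ Σ_{[γ]} d_{[γ]} O_γ(Φ)`) is the companion file
`UnitaryGroupGeometricSide`. What is deliberately NOT here: semisimplicity of rational elements,
stable conjugacy, normalisation of the measures (Tamagawa volumes).

## References

* A. Deitmar, S. Echterhoff, *Principles of Harmonic Analysis*, 2nd ed. (2014), Thm. 1.5.3,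
  Prop. 9.1.5, Thm. 9.3.2, Lemma 9.3.3 [DeitmarEchterhoff2014].
* J. D. Rogawski, *Automorphic Representations of Unitary Groups in Three Variables*, Ann. of Math.
  Stud. 123 (1990), §14.5 p. 237 (print) [Rogawski1990].
* S. Gelbart, *Automorphic forms on adele groups*, Ann. of Math. Stud. 83 (1975), Remark 9.23
  [Gelbart1975].
* I. M. Gelfand, M. I. Graev, I. I. Piatetski-Shapiro, *Representation Theory and Automorphic
  Functions* (1969), Ch. 1 §2 [GelfandGraevPiatetskiShapiro1969].
* M. S. Raghunathan, *Discrete subgroups of Lie groups* (1972), Ch. I, Remark 1.9 [Raghunathan1972].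
-/

noncomputable section

open MeasureTheory Measure Set Filter Topology NumberField
open Literature.MeasureTheory.Group
open scoped ENNReal NNReal Pointwise

namespace Literature.NumberTheory.Automorphic

-- The coset spaces `G ⧸ M` carry the Borel σ-algebras supplied by the user as binder instances
-- (`[MeasurableSpace (G ⧸ M)] [BorelSpace (G ⧸ M)]`, found before Mathlib's quotient σ-algebra).

universe u

/-! ### Centralisers of lattice elements: the topological lemma -/

section Centralizer

variable {G : Type*} [Group G] [TopologicalSpace G] [IsTopologicalGroup G]

/-- The centraliser of an element of a Hausdorff topological group is closed (it is the equaliser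
of `g ↦ γ g` and `g ↦ g γ`; cf. `isClosed_centralizer_singleton` of `QuaternionUnitsTraceClasses`,
which this file does not import). [folklore] -/
private theorem isClosed_centralizer_singleton' [T2Space G] (γ : G) :
    IsClosed ((Subgroup.centralizer ({γ} : Set G) : Subgroup G) : Set G) := by
  have h : ((Subgroup.centralizer ({γ} : Set G) : Subgroup G) : Set G) =
      {g : G | γ * g = g * γ} := by
    ext g
    rw [SetLike.mem_coe, Subgroup.mem_centralizer_iff]
    simp only [Set.mem_singleton_iff, forall_eq, Set.mem_setOf_eq]
  rw [h]
  exact isClosed_eq (continuous_const.mul continuous_id) (continuous_id.mul continuous_const)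

variable [LocallyCompactSpace G] [T2Space G] (L Γ : Subgroup G)

/-- **Centralisers of lattice elements are cocompact modulo the lattice — set form.** Let `G` be a
locally compact Hausdorff group, `L ≤ G` a subgroup with `G ⧸ L` compact, `Γ ≤ L` a DISCRETE subgroup
with `L = Γ · C_L(Γ)` (every `ℓ ∈ L` is `γ a` with `γ ∈ Γ` and `a` centralising `Γ`; e.g. `L = A Γ`
with `A` central, or `L = Γ`), and `γ ∈ Γ`. Then there is a compact `K ⊆ C_G(γ)` with
`C_G(γ) ⊆ K · (L ∩ C_G(γ))`. Proof: `G = C · L` with `C` compact; for `g ∈ C_G(γ)`, `g = c δ a`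
(`c ∈ C`, `δ ∈ Γ`, `a ∈ C(Γ)`) and `δ γ δ⁻¹ = c⁻¹ γ c ∈ Γ ∩ C⁻¹ γ C`, a finite set (discrete meets
compact); with one `δ_t ∈ Γ` chosen for each such conjugate `t`, `δ_t⁻¹ δ ∈ Γ_γ` and
`g = (c δ_t) · (δ_t⁻¹ δ a) ∈ (C δ_t ∩ C_G(γ)) · (L ∩ C_G(γ))`. This is the classical lemma behind the
geometric side of the trace formula for a compact quotient — the compactness of `Γ_γ \ G_γ` for a
uniform lattice `Γ` (Gelfand–Graev–Piatetski-Shapiro (1969), Ch. 1 §2; Deitmar–Echterhoff (2014),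
Lemma 9.3.3 states the finite-volume consequence) — in a form that also covers `L = A_G · G(K)`.
[cite: GelfandGraevPiatetskiShapiro1969, Ch. 1 §2] -/
theorem exists_isCompact_centralizer_subset_mul (hΓL : Γ ≤ L)
    (hL : ∀ ℓ ∈ L, ∃ γ ∈ Γ, γ⁻¹ * ℓ ∈ Subgroup.centralizer (Γ : Set G))
    [DiscreteTopology Γ] [CompactSpace (G ⧸ L)] {γ : G} (hγ : γ ∈ Γ) :
    ∃ K : Set G, IsCompact K ∧ K ⊆ Subgroup.centralizer ({γ} : Set G) ∧
      ((Subgroup.centralizer ({γ} : Set G) : Subgroup G) : Set G) ⊆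
        K * ((L ⊓ Subgroup.centralizer ({γ} : Set G) : Subgroup G) : Set G) := by
  classical
  -- `G = C · L` with `C` compact
  obtain ⟨C, hC, hCuniv⟩ := exists_isCompact_image_mk_superset L (isCompact_univ (X := G ⧸ L))
  have hdec : ∀ g : G, ∃ c ∈ C, c⁻¹ * g ∈ L := fun g => by
    obtain ⟨c, hc, hcg⟩ := hCuniv (Set.mem_univ (QuotientGroup.mk g : G ⧸ L))
    exact ⟨c, hc, QuotientGroup.eq.1 hcg⟩
  -- the compact set `S = C⁻¹ γ C` meets the discrete closed `Γ` in a finite set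
  set S : Set G := (fun p : G × G => p.1⁻¹ * γ * p.2) '' (C ×ˢ C) with hS
  have hSc : IsCompact S := (hC.prod hC).image (by fun_prop)
  have hΓc : IsClosed ((Γ : Subgroup G) : Set G) := Subgroup.isClosed_of_discrete
  have hΓd : IsDiscrete ((Γ : Subgroup G) : Set G) :=
    isDiscrete_iff_discreteTopology.mpr ‹DiscreteTopology Γ›
  have hfin : (S ∩ (Γ : Set G)).Finite :=
    (hSc.inter_right hΓc).finite (hΓd.mono Set.inter_subset_right)
  -- one `δ_t ∈ Γ` for every `Γ`-conjugate `t` of `γ`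
  have hpick : ∀ t : G, ∃ δ : G, δ ∈ Γ ∧
      ((∃ δ' ∈ Γ, δ' * γ * δ'⁻¹ = t) → δ * γ * δ⁻¹ = t) := by
    intro t
    by_cases h : ∃ δ' ∈ Γ, δ' * γ * δ'⁻¹ = t
    · obtain ⟨δ', hδ', h'⟩ := h
      exact ⟨δ', hδ', fun _ => h'⟩
    · exact ⟨1, Γ.one_mem, fun h' => absurd h' h⟩
  choose pick hpickΓ hpickeq using hpick
  set E : Set G := ⋃ t ∈ hfin.toFinset, (fun c : G => c * pick t) '' C with hE
  have hEc : IsCompact E :=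
    hfin.toFinset.isCompact_biUnion fun t _ => hC.image (continuous_mul_const _)
  set Z : Subgroup G := Subgroup.centralizer ({γ} : Set G) with hZ
  have hZc : IsClosed (Z : Set G) := isClosed_centralizer_singleton' γ
  have hmemZ : ∀ g : G, g ∈ Z ↔ γ * g = g * γ := fun g => by
    rw [hZ, Subgroup.mem_centralizer_iff]
    simp only [Set.mem_singleton_iff, forall_eq]
  refine ⟨E ∩ (Z : Set G), hEc.inter_right hZc, Set.inter_subset_right, fun g hg => ?_⟩
  -- decompose `g = c δ a`
  obtain ⟨c, hc, hℓ⟩ := hdec g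
  obtain ⟨δ, hδ, ha⟩ := hL _ hℓ
  set a : G := δ⁻¹ * (c⁻¹ * g) with ha_def
  have hg' : g = c * δ * a := by rw [ha_def]; group
  have haγ : γ * a = a * γ := (Subgroup.mem_centralizer_iff.1 ha) γ hγ
  have hγg : γ * g = g * γ := (hmemZ g).1 hg
  have hγg' : γ * (c * δ * a) = c * δ * a * γ := by rw [← hg']; exact hγg
  -- `δ γ δ⁻¹ = c⁻¹ γ c ∈ S ∩ Γ`
  have ht : c⁻¹ * γ * c = δ * γ * δ⁻¹ := by
    calc c⁻¹ * γ * c = c⁻¹ * (γ * (c * δ * a)) * (a⁻¹ * δ⁻¹) := by group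
      _ = c⁻¹ * (c * δ * a * γ) * (a⁻¹ * δ⁻¹) := by rw [hγg']
      _ = δ * (a * γ) * (a⁻¹ * δ⁻¹) := by group
      _ = δ * (γ * a) * (a⁻¹ * δ⁻¹) := by rw [haγ]
      _ = δ * γ * δ⁻¹ := by group
  set t : G := δ * γ * δ⁻¹ with ht_def
  have htS : t ∈ S := ⟨(c, c), ⟨hc, hc⟩, ht⟩
  have htΓ : t ∈ (Γ : Set G) := Γ.mul_mem (Γ.mul_mem hδ hγ) (Γ.inv_mem hδ)
  have htT : t ∈ hfin.toFinset := hfin.mem_toFinset.2 ⟨htS, htΓ⟩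
  -- the chosen representative `p = δ_t`
  set p : G := pick t with hp_def
  have hpΓ : p ∈ Γ := hpickΓ t
  have hpt : p * γ * p⁻¹ = δ * γ * δ⁻¹ := hpickeq t ⟨δ, hδ, rfl⟩
  -- `m = p⁻¹ δ a ∈ L ∩ C_G(γ)` and `e = c p ∈ E ∩ C_G(γ)` with `g = e m`
  set m : G := p⁻¹ * δ * a with hm_def
  have hmγ : γ * m = m * γ := by
    have h1 : γ * (p⁻¹ * δ) = p⁻¹ * δ * γ := by
      calc γ * (p⁻¹ * δ) = p⁻¹ * (p * γ * p⁻¹) * δ := by group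
        _ = p⁻¹ * (δ * γ * δ⁻¹) * δ := by rw [hpt]
        _ = p⁻¹ * δ * γ := by group
    calc γ * m = γ * (p⁻¹ * δ) * a := by rw [hm_def]; group
      _ = p⁻¹ * δ * γ * a := by rw [h1]
      _ = p⁻¹ * δ * (γ * a) := by group
      _ = p⁻¹ * δ * (a * γ) := by rw [haγ]
      _ = m * γ := by rw [hm_def]; group
  have hmZ : m ∈ Z := (hmemZ m).2 hmγ
  have haL : a ∈ L := L.mul_mem (L.inv_mem (hΓL hδ)) hℓ
  have hmL : m ∈ L := L.mul_mem (L.mul_mem (L.inv_mem (hΓL hpΓ)) (hΓL hδ)) haL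
  have hem : c * p * m = g := by rw [hg', hm_def]; group
  have heZ : c * p ∈ Z := by
    have h : c * p = g * m⁻¹ := by rw [← hem]; group
    rw [h]
    exact Z.mul_mem hg (Z.inv_mem hmZ)
  have heE : c * p ∈ E := Set.mem_iUnion₂.2 ⟨t, htT, c, hc, rfl⟩
  exact Set.mem_mul.2 ⟨c * p, ⟨heE, heZ⟩, m, Subgroup.mem_inf.2 ⟨hmL, hmZ⟩, hem⟩

/-- **`C_G(γ) ⧸ (L ∩ C_G(γ))` is compact** for `γ ∈ Γ`, `Γ ≤ L` discrete with `L = Γ · C_L(Γ)` and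
`G ⧸ L` compact (`exists_isCompact_centralizer_subset_mul` and the tree's criterion
`compactSpace_quotient_subgroupOf_of_subset_mul`): the classical compactness of `Γ_γ \ G_γ` for a
uniform lattice `Γ` (Gelfand–Graev–Piatetski-Shapiro (1969), Ch. 1 §2; Deitmar–Echterhoff (2014),
Lemma 9.3.3 for the finite-volume form). [cite: GelfandGraevPiatetskiShapiro1969, Ch. 1 §2] -/
theorem compactSpace_centralizer_quotient_of_le (hΓL : Γ ≤ L)
    (hL : ∀ ℓ ∈ L, ∃ γ ∈ Γ, γ⁻¹ * ℓ ∈ Subgroup.centralizer (Γ : Set G))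
    [DiscreteTopology Γ] [CompactSpace (G ⧸ L)] {γ : G} (hγ : γ ∈ Γ) :
    CompactSpace (↥(Subgroup.centralizer ({γ} : Set G)) ⧸
      (L ⊓ Subgroup.centralizer ({γ} : Set G)).subgroupOf (Subgroup.centralizer ({γ} : Set G))) := by
  obtain ⟨K, hK, hKZ, hZK⟩ := exists_isCompact_centralizer_subset_mul L Γ hΓL hL hγ
  exact compactSpace_quotient_subgroupOf_of_subset_mul (L ⊓ Subgroup.centralizer ({γ} : Set G))
    (Subgroup.centralizer ({γ} : Set G)) (isClosed_centralizer_singleton' γ) hK hKZ hZK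

end Centralizer

/-! ### Invariant measures on coset spaces of unimodular closed subgroups -/

section Unimodular

variable {G : Type*} [Group G] [TopologicalSpace G] [IsTopologicalGroup G] [LocallyCompactSpace G]
  [SecondCountableTopology G] [T2Space G] [MeasurableSpace G] [BorelSpace G]

/-- **A Haar measure on a discrete (second countable) group is right invariant**: the group carries
the uniform lattice `⊤` (`G ⧸ ⊤` is a point), so the tree's
`LevelOrbit.isMulRightInvariant_of_compactSpace_quotient` applies (equivalently: Haar measure is a
multiple of counting measure; Folland (1995), §2.4). [folklore] -/
private theorem isMulRightInvariant_of_discreteTopology [DiscreteTopology G] (ν : Measure G)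
    [IsHaarMeasure ν] : ν.IsMulRightInvariant := by
  haveI : Subsingleton (G ⧸ (⊤ : Subgroup G)) := QuotientGroup.subsingleton_quotient_top
  haveI : CompactSpace (G ⧸ (⊤ : Subgroup G)) := Finite.compactSpace
  exact LevelOrbit.isMulRightInvariant_of_compactSpace_quotient (⊤ : Subgroup G) ν

/-- **Invariant measure on `G ⧸ M` for `M` closed with `G` and `M` unimodular** (Deitmar–Echterhoff
(2014), Thm. 1.5.3: an invariant Radon measure on `G ⧸ M` exists iff `Δ_G|_M = Δ_M`; here both are
`1`): if some Haar measure `ρ` of `M` and some Haar measure `ν` of `G` are right invariant, there is a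
non-zero `G`-invariant Borel measure on `G ⧸ M` finite on compact sets (the tree's `quotientMeasure`,
`ρ` being inversion invariant by `isInvInvariant_of_isMulRightInvariant`).
[cite: DeitmarEchterhoff2014, Thm. 1.5.3] -/
theorem exists_smulInvariantMeasure_quotient_of_isMulRightInvariant (M : Subgroup G)
    (hM : IsClosed (M : Set G)) [MeasurableSpace M] [BorelSpace M] (ρ : Measure M)
    [IsHaarMeasure ρ] [ρ.IsMulRightInvariant] (ν : Measure G) [IsHaarMeasure ν]
    [ν.IsMulRightInvariant] [MeasurableSpace (G ⧸ M)] [BorelSpace (G ⧸ M)] :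
    ∃ μ : Measure (G ⧸ M), SMulInvariantMeasure G (G ⧸ M) μ ∧ IsFiniteMeasureOnCompacts μ ∧
      μ ≠ 0 := by
  haveI : LocallyCompactSpace M := hM.isClosedEmbedding_subtypeVal.locallyCompactSpace
  haveI : SecondCountableTopology M := TopologicalSpace.Subtype.secondCountableTopology _
  haveI : ρ.IsInvInvariant := isInvInvariant_of_isMulRightInvariant ρ
  exact ⟨quotientMeasure M ρ hM ν, smulInvariantMeasure_quotientMeasure M ρ hM ν, inferInstance,
    quotientMeasure_ne_zero M ρ hM ν⟩

end Unimodular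

/-! ### Adelic group data: compact centraliser quotients; the anisotropic regime `A_G = ⊥` -/

namespace AdelicGroupData

variable {K : Type} [Field K] [NumberField K] (𝒢 : AdelicGroupData.{u} K)

/-- **`G_γ ⧸ (A_G G(K) ∩ G_γ)` is compact for every rational `γ`** on an adelic group datum with
discrete `G(K)` and COMPACT automorphic quotient (`G_γ = C_{G(𝔸_K)}(γ)`;
`compactSpace_centralizer_quotient_of_le` with `L = A_G · G(K) = G(K) · C(G(K))`,
`exists_inv_mul_mem_centralizer_of_le_center`): the per-class compactness hypothesis of the tree's
geometric side `exists_lintegral_conjTsum_eq_tsum` (Gelbart (1975), Remark 9.23: the volumes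
`vol(Γ(γ) A \ G_γ)` are finite). [cite: Gelbart1975, Remark 9.23] -/
theorem compactSpace_centralizer_quotient [LocallyCompactSpace 𝒢.Adelic] [T2Space 𝒢.Adelic]
    (hdisc : 𝒢.IsDiscreteRational) [CompactSpace 𝒢.automorphicQuotient] {γ : 𝒢.Adelic}
    (hγ : γ ∈ 𝒢.arithmeticSubgroup) :
    CompactSpace (↥(Subgroup.centralizer ({γ} : Set 𝒢.Adelic)) ⧸
      (𝒢.quotientSubgroup ⊓ Subgroup.centralizer ({γ} : Set 𝒢.Adelic)).subgroupOf
        (Subgroup.centralizer ({γ} : Set 𝒢.Adelic))) := by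
  haveI : DiscreteTopology 𝒢.arithmeticSubgroup := hdisc
  haveI : CompactSpace (𝒢.Adelic ⧸ 𝒢.quotientSubgroup) := ‹CompactSpace 𝒢.automorphicQuotient›
  exact compactSpace_centralizer_quotient_of_le 𝒢.quotientSubgroup 𝒢.arithmeticSubgroup
    𝒢.arithmeticSubgroup_le_quotientSubgroup
    (exists_inv_mul_mem_centralizer_of_le_center 𝒢.arithmeticSubgroup 𝒢.center' 𝒢.center'_le) hγ

/-- For `A_G = ⊥` the subgroup `A_G · G(K)` IS `G(K)`. [folklore] -/
private theorem quotientSubgroup_eq_arithmeticSubgroup_of_center'_eq_bot (hc : 𝒢.center' = ⊥) :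
    𝒢.quotientSubgroup = 𝒢.arithmeticSubgroup := by
  rw [quotientSubgroup, hc, bot_sup_eq]

/-- For `A_G = ⊥` and discrete `G(K)`, `A_G · G(K)` is discrete. [folklore] -/
private theorem discreteTopology_quotientSubgroup_of_center'_eq_bot (hc : 𝒢.center' = ⊥)
    (hdisc : 𝒢.IsDiscreteRational) : DiscreteTopology 𝒢.quotientSubgroup := by
  rw [𝒢.quotientSubgroup_eq_arithmeticSubgroup_of_center'_eq_bot hc]
  exact hdisc

section Anisotropic

variable [LocallyCompactSpace 𝒢.Adelic] [SecondCountableTopology 𝒢.Adelic] [T2Space 𝒢.Adelic]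
  [MeasurableSpace 𝒢.Adelic] [BorelSpace 𝒢.Adelic]
  (hc : 𝒢.center' = ⊥) (hdisc : 𝒢.IsDiscreteRational)

include hc hdisc

/-- **`G(𝔸_K)` is unimodular for a datum with `A_G = ⊥`, discrete `G(K)` and compact automorphic
quotient**: `G(K)` is then a uniform lattice in `G(𝔸_K)` (Deitmar–Echterhoff (2014), Prop. 9.1.5 and
Thm. 9.1.6; tree `LevelOrbit.isMulRightInvariant_of_compactSpace_quotient`, Raghunathan (1972) Ch. I
Rem. 1.9). [cite: DeitmarEchterhoff2014, Prop. 9.1.5] -/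
theorem isMulRightInvariant_of_center'_eq_bot [CompactSpace 𝒢.automorphicQuotient]
    (ν : Measure 𝒢.Adelic) [IsHaarMeasure ν] : ν.IsMulRightInvariant := by
  haveI := 𝒢.discreteTopology_quotientSubgroup_of_center'_eq_bot hc hdisc
  haveI : CompactSpace (𝒢.Adelic ⧸ 𝒢.quotientSubgroup) := ‹CompactSpace 𝒢.automorphicQuotient›
  exact LevelOrbit.isMulRightInvariant_of_compactSpace_quotient 𝒢.quotientSubgroup ν

/-- **`G_γ = C_{G(𝔸_K)}(γ)` is unimodular for every rational `γ`** (datum with `A_G = ⊥`, discrete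
`G(K)`, compact automorphic quotient): `G(K)_γ = G(K) ∩ G_γ` is a uniform lattice in `G_γ`
(`compactSpace_centralizer_quotient`), so every Haar measure of `G_γ` is right invariant
(Deitmar–Echterhoff (2014), Lemma 9.3.3: "the centralizer `G_γ` is unimodular").
[cite: DeitmarEchterhoff2014, Lemma 9.3.3] -/
theorem isMulRightInvariant_centralizer_of_center'_eq_bot [CompactSpace 𝒢.automorphicQuotient]
    {γ : 𝒢.Adelic} (hγ : γ ∈ 𝒢.arithmeticSubgroup)
    (νZ : Measure ↥(Subgroup.centralizer ({γ} : Set 𝒢.Adelic))) [IsHaarMeasure νZ] :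
    νZ.IsMulRightInvariant := by
  have hZc : IsClosed ((Subgroup.centralizer ({γ} : Set 𝒢.Adelic) : Subgroup 𝒢.Adelic) :
      Set 𝒢.Adelic) := isClosed_centralizer_singleton' γ
  haveI : LocallyCompactSpace ↥(Subgroup.centralizer ({γ} : Set 𝒢.Adelic)) :=
    hZc.isClosedEmbedding_subtypeVal.locallyCompactSpace
  haveI : SecondCountableTopology ↥(Subgroup.centralizer ({γ} : Set 𝒢.Adelic)) :=
    TopologicalSpace.Subtype.secondCountableTopology _
  -- the lattice `G(K)_γ` of `G_γ` is discrete
  haveI := 𝒢.discreteTopology_quotientSubgroup_of_center'_eq_bot hc hdisc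
  have hmemΛ : ∀ x : ↥(Subgroup.centralizer ({γ} : Set 𝒢.Adelic)),
      x ∈ (𝒢.quotientSubgroup ⊓ Subgroup.centralizer ({γ} : Set 𝒢.Adelic)).subgroupOf
        (Subgroup.centralizer ({γ} : Set 𝒢.Adelic)) → (x : 𝒢.Adelic) ∈ 𝒢.quotientSubgroup :=
    fun x hx => (Subgroup.mem_inf.1 (Subgroup.mem_subgroupOf.1 hx)).1
  haveI : DiscreteTopology ↥((𝒢.quotientSubgroup ⊓
      Subgroup.centralizer ({γ} : Set 𝒢.Adelic)).subgroupOf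
        (Subgroup.centralizer ({γ} : Set 𝒢.Adelic))) := by
    refine DiscreteTopology.of_continuous_injective
      (f := fun x => (⟨((x : ↥(Subgroup.centralizer ({γ} : Set 𝒢.Adelic))) : 𝒢.Adelic),
        hmemΛ x x.2⟩ : 𝒢.quotientSubgroup)) ?_ ?_
    · exact (continuous_subtype_val.comp continuous_subtype_val).subtype_mk _
    · intro a b hab
      have h : (((a : ↥(Subgroup.centralizer ({γ} : Set 𝒢.Adelic)))) : 𝒢.Adelic) =
          (((b : ↥(Subgroup.centralizer ({γ} : Set 𝒢.Adelic)))) : 𝒢.Adelic) :=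
        congrArg (fun y : 𝒢.quotientSubgroup => (y : 𝒢.Adelic)) hab
      exact Subtype.ext (Subtype.ext h)
  -- and cocompact
  haveI := 𝒢.compactSpace_centralizer_quotient hdisc hγ
  exact LevelOrbit.isMulRightInvariant_of_compactSpace_quotient
    ((𝒢.quotientSubgroup ⊓ Subgroup.centralizer ({γ} : Set 𝒢.Adelic)).subgroupOf
      (Subgroup.centralizer ({γ} : Set 𝒢.Adelic))) νZ

/-- **The orbital measure on `G(𝔸_K) ⧸ G_γ`**: for every rational `γ` there is a non-zero
`G(𝔸_K)`-invariant Borel measure finite on compact sets on `G(𝔸_K) ⧸ C_{G(𝔸_K)}(γ)` (datum with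
`A_G = ⊥`, discrete `G(K)`, compact automorphic quotient: both groups are unimodular,
`exists_smulInvariantMeasure_quotient_of_isMulRightInvariant`). It carries the orbital integrals
`∫_{G_γ \ G} Φ(x⁻¹ γ x) dx` (Deitmar–Echterhoff (2014), Thm. 9.3.2 and Lemma 9.3.3).
[cite: DeitmarEchterhoff2014, Lemma 9.3.3] -/
theorem exists_smulInvariantMeasure_quotient_centralizer_of_center'_eq_bot
    [CompactSpace 𝒢.automorphicQuotient] {γ : 𝒢.Adelic} (hγ : γ ∈ 𝒢.arithmeticSubgroup)
    [MeasurableSpace (𝒢.Adelic ⧸ Subgroup.centralizer ({γ} : Set 𝒢.Adelic))]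
    [BorelSpace (𝒢.Adelic ⧸ Subgroup.centralizer ({γ} : Set 𝒢.Adelic))] :
    ∃ μC : Measure (𝒢.Adelic ⧸ Subgroup.centralizer ({γ} : Set 𝒢.Adelic)),
      SMulInvariantMeasure 𝒢.Adelic _ μC ∧ IsFiniteMeasureOnCompacts μC ∧ μC ≠ 0 := by
  have hZc : IsClosed ((Subgroup.centralizer ({γ} : Set 𝒢.Adelic) : Subgroup 𝒢.Adelic) :
      Set 𝒢.Adelic) := isClosed_centralizer_singleton' γ
  haveI : LocallyCompactSpace ↥(Subgroup.centralizer ({γ} : Set 𝒢.Adelic)) :=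
    hZc.isClosedEmbedding_subtypeVal.locallyCompactSpace
  haveI : (haar : Measure ↥(Subgroup.centralizer ({γ} : Set 𝒢.Adelic))).IsMulRightInvariant :=
    𝒢.isMulRightInvariant_centralizer_of_center'_eq_bot hc hdisc hγ haar
  haveI : (haar : Measure 𝒢.Adelic).IsMulRightInvariant :=
    𝒢.isMulRightInvariant_of_center'_eq_bot hc hdisc haar
  exact exists_smulInvariantMeasure_quotient_of_isMulRightInvariant
    (Subgroup.centralizer ({γ} : Set 𝒢.Adelic)) hZc haar haar

/-- **The measure on `G(𝔸_K) ⧸ (A_G G(K) ∩ G_γ) = G(𝔸_K) ⧸ G(K)_γ`**: for every `γ` there is a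
non-zero `G(𝔸_K)`-invariant Borel measure finite on compact sets on `G(𝔸_K) ⧸ (A_G G(K) ∩ G_γ)`
(datum with `A_G = ⊥`, discrete `G(K)`, compact automorphic quotient: `A_G G(K) ∩ G_γ` is a
discrete, hence unimodular, closed subgroup of the unimodular `G(𝔸_K)`). The intermediate quotient
of the unfolding `Γ \ G → Γ_γ \ G → G_γ \ G` (Deitmar–Echterhoff (2014), proof of Thm. 9.3.2).
[cite: DeitmarEchterhoff2014, Thm. 9.3.2] -/
theorem exists_smulInvariantMeasure_quotient_inf_centralizer_of_center'_eq_bot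
    [CompactSpace 𝒢.automorphicQuotient] (γ : 𝒢.Adelic)
    [MeasurableSpace (𝒢.Adelic ⧸ (𝒢.quotientSubgroup ⊓
      Subgroup.centralizer ({γ} : Set 𝒢.Adelic)))]
    [BorelSpace (𝒢.Adelic ⧸ (𝒢.quotientSubgroup ⊓ Subgroup.centralizer ({γ} : Set 𝒢.Adelic)))] :
    ∃ μH : Measure (𝒢.Adelic ⧸ (𝒢.quotientSubgroup ⊓
        Subgroup.centralizer ({γ} : Set 𝒢.Adelic))),
      SMulInvariantMeasure 𝒢.Adelic _ μH ∧ IsFiniteMeasureOnCompacts μH ∧ μH ≠ 0 := by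
  haveI := 𝒢.discreteTopology_quotientSubgroup_of_center'_eq_bot hc hdisc
  -- `A_G G(K) ∩ G_γ ≤ G(K)` is discrete and closed
  haveI : DiscreteTopology ↥(𝒢.quotientSubgroup ⊓ Subgroup.centralizer ({γ} : Set 𝒢.Adelic)) := by
    refine DiscreteTopology.of_continuous_injective
      (f := fun x : ↥(𝒢.quotientSubgroup ⊓ Subgroup.centralizer ({γ} : Set 𝒢.Adelic)) =>
        (⟨(x : 𝒢.Adelic), (Subgroup.mem_inf.1 x.2).1⟩ : 𝒢.quotientSubgroup)) ?_ ?_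
    · exact continuous_subtype_val.subtype_mk _
    · intro a b hab
      exact Subtype.ext (congrArg (fun y : 𝒢.quotientSubgroup => (y : 𝒢.Adelic)) hab)
  have hMc : IsClosed ((𝒢.quotientSubgroup ⊓ Subgroup.centralizer ({γ} : Set 𝒢.Adelic) :
      Subgroup 𝒢.Adelic) : Set 𝒢.Adelic) := Subgroup.isClosed_of_discrete
  haveI : LocallyCompactSpace ↥(𝒢.quotientSubgroup ⊓ Subgroup.centralizer ({γ} : Set 𝒢.Adelic)) :=
    hMc.isClosedEmbedding_subtypeVal.locallyCompactSpace
  haveI : SecondCountableTopology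
      ↥(𝒢.quotientSubgroup ⊓ Subgroup.centralizer ({γ} : Set 𝒢.Adelic)) :=
    TopologicalSpace.Subtype.secondCountableTopology _
  haveI : (haar : Measure
      ↥(𝒢.quotientSubgroup ⊓ Subgroup.centralizer ({γ} : Set 𝒢.Adelic))).IsMulRightInvariant :=
    isMulRightInvariant_of_discreteTopology haar
  haveI : (haar : Measure 𝒢.Adelic).IsMulRightInvariant :=
    𝒢.isMulRightInvariant_of_center'_eq_bot hc hdisc haar
  exact exists_smulInvariantMeasure_quotient_of_isMulRightInvariant
    (𝒢.quotientSubgroup ⊓ Subgroup.centralizer ({γ} : Set 𝒢.Adelic)) hMc haar haar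

end Anisotropic

end AdelicGroupData

/-! ### The unitary group of an anisotropic hermitian matrix over a CM field -/

namespace UnitaryGroup

open Literature.AlgebraicGeometry.ShimuraVarieties (hermForm)

variable (L : Type) [Field L] [NumberField L] [IsCMField L] (N : ℕ) (H : Matrix (Fin N) (Fin N) L)

/-- **`U(H)(𝔸)_γ ⧸ U(H)(L⁺)_γ` is compact for anisotropic `H` and every rational `γ ∈ U(H)(L⁺)`**
(`(cmDatum L N H).Adelic = U(H)(𝔸_{L⁺})`, `G_γ` the adelic centraliser, `U(H)(L⁺)_γ` its rational
points; the quotient is written as the coset space of `G_γ` by `A_G G(K) ∩ G_γ`, `A_G = ⊥`): compact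
automorphic quotient (Godement's criterion, `compactSpace_cmDatum_automorphicQuotient`), discrete
rational points (`cmDatum_isDiscreteRational`), and `AdelicGroupData.compactSpace_centralizer_quotient`.
For Rogawski's anisotropic inner form `G′` this is the finiteness behind the `O`-expansion of
`T_{G′}(f′)` [§14.5 p. 237 (print)]. [cite: Rogawski1990, §14.5 p. 237] -/
theorem compactSpace_centralizer_quotient_cmDatum
    (hanis : ∀ x : Fin N → L, hermForm (cmConjRingHom L) H x x = 0 → x = 0)
    {γ : (cmDatum L N H).Adelic} (hγ : γ ∈ (cmDatum L N H).arithmeticSubgroup) :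
    CompactSpace (↥(Subgroup.centralizer ({γ} : Set (cmDatum L N H).Adelic)) ⧸
      ((cmDatum L N H).quotientSubgroup ⊓
        Subgroup.centralizer ({γ} : Set (cmDatum L N H).Adelic)).subgroupOf
        (Subgroup.centralizer ({γ} : Set (cmDatum L N H).Adelic))) := by
  haveI := compactSpace_cmDatum_automorphicQuotient L N H hanis
  exact (cmDatum L N H).compactSpace_centralizer_quotient (cmDatum_isDiscreteRational L N H) hγ

variable [MeasurableSpace (cmDatum L N H).Adelic] [BorelSpace (cmDatum L N H).Adelic]

/-- **`U(H)(𝔸_{L⁺})` is unimodular for anisotropic `H`**: every Haar measure on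
`(cmDatum L N H).Adelic` is right invariant (uniform lattice `U(H)(L⁺)`; Deitmar–Echterhoff (2014),
Prop. 9.1.5 / Thm. 9.1.6). [cite: DeitmarEchterhoff2014, Prop. 9.1.5] -/
theorem isMulRightInvariant_cmDatum
    (hanis : ∀ x : Fin N → L, hermForm (cmConjRingHom L) H x x = 0 → x = 0)
    (ν : Measure (cmDatum L N H).Adelic) [IsHaarMeasure ν] : ν.IsMulRightInvariant := by
  haveI := compactSpace_cmDatum_automorphicQuotient L N H hanis
  exact (cmDatum L N H).isMulRightInvariant_of_center'_eq_bot (cmDatum_center' L N H)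
    (cmDatum_isDiscreteRational L N H) ν

/-- **The adelic centraliser `U(H)(𝔸)_γ` of a rational `γ ∈ U(H)(L⁺)` is unimodular** (`H`
anisotropic; Deitmar–Echterhoff (2014), Lemma 9.3.3). [cite: DeitmarEchterhoff2014, Lemma 9.3.3] -/
theorem isMulRightInvariant_centralizer_cmDatum
    (hanis : ∀ x : Fin N → L, hermForm (cmConjRingHom L) H x x = 0 → x = 0)
    {γ : (cmDatum L N H).Adelic} (hγ : γ ∈ (cmDatum L N H).arithmeticSubgroup)
    (νZ : Measure ↥(Subgroup.centralizer ({γ} : Set (cmDatum L N H).Adelic))) [IsHaarMeasure νZ] :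
    νZ.IsMulRightInvariant := by
  haveI := compactSpace_cmDatum_automorphicQuotient L N H hanis
  exact (cmDatum L N H).isMulRightInvariant_centralizer_of_center'_eq_bot (cmDatum_center' L N H)
    (cmDatum_isDiscreteRational L N H) hγ νZ

/-- **The orbital measure on `U(H)(𝔸) ⧸ U(H)(𝔸)_γ`** for anisotropic `H` and rational `γ`: a
non-zero invariant Borel measure finite on compact sets, carrying the orbital integrals
`O_γ(Φ) = ∫ Φ(y γ y⁻¹)` of the trace formula for the inner form [Rogawski1990, §14.5 p. 237 (print)].
[cite: Rogawski1990, §14.5 p. 237] -/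
theorem exists_smulInvariantMeasure_quotient_centralizer_cmDatum
    (hanis : ∀ x : Fin N → L, hermForm (cmConjRingHom L) H x x = 0 → x = 0)
    {γ : (cmDatum L N H).Adelic} (hγ : γ ∈ (cmDatum L N H).arithmeticSubgroup)
    [MeasurableSpace ((cmDatum L N H).Adelic ⧸
      Subgroup.centralizer ({γ} : Set (cmDatum L N H).Adelic))]
    [BorelSpace ((cmDatum L N H).Adelic ⧸
      Subgroup.centralizer ({γ} : Set (cmDatum L N H).Adelic))] :
    ∃ μC : Measure ((cmDatum L N H).Adelic ⧸
        Subgroup.centralizer ({γ} : Set (cmDatum L N H).Adelic)),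
      SMulInvariantMeasure (cmDatum L N H).Adelic _ μC ∧ IsFiniteMeasureOnCompacts μC ∧
        μC ≠ 0 := by
  haveI := compactSpace_cmDatum_automorphicQuotient L N H hanis
  exact (cmDatum L N H).exists_smulInvariantMeasure_quotient_centralizer_of_center'_eq_bot
    (cmDatum_center' L N H) (cmDatum_isDiscreteRational L N H) hγ

/-- **The measure on `U(H)(𝔸) ⧸ U(H)(L⁺)_γ`** for anisotropic `H` (any `γ`): a non-zero invariant
Borel measure finite on compact sets on `(cmDatum L N H).Adelic ⧸ (A_G G(K) ∩ C(γ))`.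
[cite: DeitmarEchterhoff2014, Thm. 9.3.2] -/
theorem exists_smulInvariantMeasure_quotient_inf_centralizer_cmDatum
    (hanis : ∀ x : Fin N → L, hermForm (cmConjRingHom L) H x x = 0 → x = 0)
    (γ : (cmDatum L N H).Adelic)
    [MeasurableSpace ((cmDatum L N H).Adelic ⧸ ((cmDatum L N H).quotientSubgroup ⊓
      Subgroup.centralizer ({γ} : Set (cmDatum L N H).Adelic)))]
    [BorelSpace ((cmDatum L N H).Adelic ⧸ ((cmDatum L N H).quotientSubgroup ⊓
      Subgroup.centralizer ({γ} : Set (cmDatum L N H).Adelic)))] :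
    ∃ μH : Measure ((cmDatum L N H).Adelic ⧸ ((cmDatum L N H).quotientSubgroup ⊓
        Subgroup.centralizer ({γ} : Set (cmDatum L N H).Adelic))),
      SMulInvariantMeasure (cmDatum L N H).Adelic _ μH ∧ IsFiniteMeasureOnCompacts μH ∧
        μH ≠ 0 := by
  haveI := compactSpace_cmDatum_automorphicQuotient L N H hanis
  exact (cmDatum L N H).exists_smulInvariantMeasure_quotient_inf_centralizer_of_center'_eq_bot
    (cmDatum_center' L N H) (cmDatum_isDiscreteRational L N H) γ

end UnitaryGroup

end Literature.NumberTheory.Automorphic
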